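import Mathlib
import Summits.Ventures.HodgeRepro.Tier4.Target

/-!
# Tier4/Line3/IntegralScalarExcess — the archimedean excess of an algebraic integer over all embeddings

Blind re-derivation cell `pub-hodge-repro`, Tier 4 «PROVE THE STEP», LINE L3, seat t4-x2 (g3, reserve wall-breaker; bus
S13860, plan item (2)).  Pure number theory on a number field `E` (Mathlib only; no object of the line): the quantity every
profile argument for `ArchCopyBound` (CopyRemainder p682977) needs is the EXCESS

  `embExcess x = Σ_{σ : E →+* ℂ} (‖σ x‖² − 1)`

of a scalar `x` over ALL complex embeddings.  For an algebraic integer `x ≠ 0`: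
* `abs_norm_eq_prod_norm_emb`: `|N_{E/ℚ}(x)| = ∏_σ ‖σ x‖`, hence `≥ 1` (`one_le_prod_norm_emb`);
* `card_le_sum_norm_emb`: `Σ_σ ‖σ x‖ ≥ [E : ℚ]` (AM–GM, `Real.geom_mean_le_arith_mean_weighted`);
* `sum_sq_le_embExcess`: `embExcess x ≥ Σ_σ (‖σ x‖ − 1)² ≥ 0`, so the excess vanishes only when `‖σ x‖ = 1` at EVERY
  embedding (`embExcess_pos_of_norm_ne_one`);
* for a CM field with conjugation `c` (`σ (c y) = conj (σ y)`): `‖σ x‖ = 1 ∀ σ ⟺ c x · x = 1` (`forall_norm_eq_one_iff`),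
  so the excess of an integral `x` with `c x · x ≠ 1` is positive (`embExcess_pos_of_conj_mul_ne_one`);
* **`exists_embExcess_gap`**: a UNIFORM gap `δ > 0` with `embExcess x ≥ δ` for every integral `x` with `c x · x ≠ 1`
  (finitely many algebraic integers of house `≤ 2`, `NumberField.Embeddings.finite_of_norm_le`; house `> 2` gives excess `≥ 1`).

In the line's vocabulary: the scalars of a non-main copy (`Copies S xm ∖ {main}`, CopyRemainder) are not all norm-one
(`lineStep`: `x ~ t x` for `c t · t = 1`), so on integral scalars some slot has `embExcess ≥ δ > 0`; the balanced-profile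
exponent of bus S13860 (F2)–(F3) is `embExcess` with the `τ̄₀`-term removed (the tree's `gaussDef` / `maj` normalisation),
which is why the uniform gap does NOT by itself give the profile condition (S13860 (F3)).

Nothing here says anything about the status of the Hodge conjecture for CM abelian varieties, which is NOT proved
(HC_CM is NOT proved by anyone in this repository).
-/

set_option autoImplicit false

noncomputable section

namespace Summit.Ventures.HodgeRepro.Tier4.Line3

open NumberField
open scoped ComplexConjugate

variable {E : Type} [Field E] [NumberField E]

/-- **THE ARCHIMEDEAN EXCESS** of `x` over all complex embeddings: `Σ_σ (‖σ x‖² − 1)`. -/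
def embExcess (x : E) : ℝ := ∑ σ : E →+* ℂ, (‖σ x‖ ^ 2 - 1)

/-- `embExcess x = Σ_σ (‖σ x‖ − 1)² + 2 Σ_σ (‖σ x‖ − 1)`. -/
theorem embExcess_eq_sq_add (x : E) :
    embExcess x = (∑ σ : E →+* ℂ, (‖σ x‖ - 1) ^ 2) + 2 * ∑ σ : E →+* ℂ, (‖σ x‖ - 1) := by
  unfold embExcess
  rw [Finset.mul_sum, ← Finset.sum_add_distrib]
  refine Finset.sum_congr rfl fun σ _ => ?_
  ring

/-- `|N_{E/ℚ}(x)| = ∏_σ ‖σ x‖` over the complex embeddings. -/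
theorem abs_norm_eq_prod_norm_emb (x : E) : |Algebra.norm ℚ x| = ∏ σ : E →+* ℂ, ‖σ x‖ := by
  have h := Algebra.norm_eq_prod_embeddings ℂ x (K := ℚ)
  have h1 : ((Algebra.norm ℚ x : ℚ) : ℂ) = ∏ σ : E →+* ℂ, σ x := by
    rw [eq_ratCast] at h
    rw [h]
    exact (Fintype.prod_equiv RingHom.equivRatAlgHom _ _ (fun σ => rfl)).symm
  have h2 : ‖((Algebra.norm ℚ x : ℚ) : ℂ)‖ = |Algebra.norm ℚ x| := by
    rw [Complex.norm_ratCast, Rat.cast_abs]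
  rw [← h2, h1, norm_prod]

/-- The norm of a non-zero algebraic integer is an integer of absolute value `≥ 1`. -/
theorem one_le_abs_norm {x : E} (hx : IsIntegral ℤ x) (h0 : x ≠ 0) : 1 ≤ |Algebra.norm ℚ x| := by
  set y : 𝓞 E := ⟨x, hx⟩ with hy
  have hy0 : y ≠ 0 := by
    intro h
    apply h0
    have := congrArg (fun z : 𝓞 E => (z : E)) h
    simpa [hy] using this
  have hne : Algebra.norm ℤ y ≠ 0 := (Algebra.norm_ne_zero_iff (R := ℤ)).mpr hy0
  have h1 : (1 : ℤ) ≤ |Algebra.norm ℤ y| := Int.one_le_abs hne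
  have h2 : ((Algebra.norm ℤ y : ℤ) : ℚ) = Algebra.norm ℚ x := Algebra.coe_norm_int y
  have h3 : ((|Algebra.norm ℤ y| : ℤ) : ℚ) = |Algebra.norm ℚ x| := by
    rw [Int.cast_abs, h2]
  have h4 : (1 : ℚ) ≤ |Algebra.norm ℚ x| := by
    rw [← h3]
    exact_mod_cast h1
  exact h4

/-- `∏_σ ‖σ x‖ ≥ 1` for a non-zero algebraic integer. -/
theorem one_le_prod_norm_emb {x : E} (hx : IsIntegral ℤ x) (h0 : x ≠ 0) : 1 ≤ ∏ σ : E →+* ℂ, ‖σ x‖ := by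
  rw [← abs_norm_eq_prod_norm_emb]
  exact_mod_cast one_le_abs_norm hx h0

/-- **AM–GM**: `Σ_σ ‖σ x‖ ≥ [E : ℚ]` for a non-zero algebraic integer. -/
theorem card_le_sum_norm_emb {x : E} (hx : IsIntegral ℤ x) (h0 : x ≠ 0) :
    (Fintype.card (E →+* ℂ) : ℝ) ≤ ∑ σ : E →+* ℂ, ‖σ x‖ := by
  set d : ℕ := Fintype.card (E →+* ℂ) with hd
  have hdpos : (0 : ℝ) < d := by
    have : 0 < d := Fintype.card_pos
    exact_mod_cast this
  have hamgm := Real.geom_mean_le_arith_mean_weighted (Finset.univ : Finset (E →+* ℂ))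
    (fun _ => (1 / d : ℝ)) (fun σ => ‖σ x‖) (fun _ _ => by positivity)
    (by rw [Finset.sum_const, Finset.card_univ, nsmul_eq_mul, ← hd]; field_simp)
    (fun _ _ => norm_nonneg _)
  have hprod : 1 ≤ ∏ σ : E →+* ℂ, ‖σ x‖ ^ (1 / d : ℝ) := by
    rw [Real.finsetProd_rpow _ _ (fun _ _ => norm_nonneg _)]
    exact Real.one_le_rpow (one_le_prod_norm_emb hx h0) (by positivity)
  have h1 : 1 ≤ (1 / d : ℝ) * ∑ σ : E →+* ℂ, ‖σ x‖ := by
    rw [← Finset.mul_sum] at hamgm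
    exact hprod.trans hamgm
  rw [one_div, le_inv_mul_iff₀ hdpos, mul_one] at h1
  exact h1

/-- `Σ_σ (‖σ x‖ − 1) ≥ 0` for a non-zero algebraic integer. -/
theorem sum_norm_emb_sub_one_nonneg {x : E} (hx : IsIntegral ℤ x) (h0 : x ≠ 0) :
    0 ≤ ∑ σ : E →+* ℂ, (‖σ x‖ - 1) := by
  rw [Finset.sum_sub_distrib, Finset.sum_const, Finset.card_univ, nsmul_eq_mul, mul_one, sub_nonneg]
  exact card_le_sum_norm_emb hx h0

/-- **THE EXCESS DOMINATES THE SQUARED DEVIATIONS**: `Σ_σ (‖σ x‖ − 1)² ≤ embExcess x` for a non-zero algebraic integer. -/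
theorem sum_sq_le_embExcess {x : E} (hx : IsIntegral ℤ x) (h0 : x ≠ 0) :
    ∑ σ : E →+* ℂ, (‖σ x‖ - 1) ^ 2 ≤ embExcess x := by
  rw [embExcess_eq_sq_add]
  linarith [sum_norm_emb_sub_one_nonneg hx h0]

/-- The excess of a non-zero algebraic integer is non-negative. -/
theorem embExcess_nonneg {x : E} (hx : IsIntegral ℤ x) (h0 : x ≠ 0) : 0 ≤ embExcess x :=
  (Finset.sum_nonneg fun _ _ => sq_nonneg _).trans (sum_sq_le_embExcess hx h0)

/-- A single deviation bounds the excess from below: `(‖σ₀ x‖ − 1)² ≤ embExcess x`. -/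
theorem sq_sub_one_le_embExcess {x : E} (hx : IsIntegral ℤ x) (h0 : x ≠ 0) (σ₀ : E →+* ℂ) :
    (‖σ₀ x‖ - 1) ^ 2 ≤ embExcess x :=
  (Finset.single_le_sum (fun σ _ => sq_nonneg (‖σ x‖ - 1)) (Finset.mem_univ σ₀)).trans
    (sum_sq_le_embExcess hx h0)

/-- **THE EXCESS IS POSITIVE UNLESS EVERY EMBEDDING HAS NORM ONE.** -/
theorem embExcess_pos_of_norm_ne_one {x : E} (hx : IsIntegral ℤ x) (h0 : x ≠ 0) {σ₀ : E →+* ℂ}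
    (hσ : ‖σ₀ x‖ ≠ 1) : 0 < embExcess x := by
  refine lt_of_lt_of_le ?_ (sq_sub_one_le_embExcess hx h0 σ₀)
  have : ‖σ₀ x‖ - 1 ≠ 0 := sub_ne_zero.2 hσ
  positivity

/-- A house `≥ 2` (some `‖σ₀ x‖ ≥ 2`) gives excess `≥ 1`. -/
theorem one_le_embExcess_of_two_le {x : E} (hx : IsIntegral ℤ x) (h0 : x ≠ 0) {σ₀ : E →+* ℂ}
    (hσ : 2 ≤ ‖σ₀ x‖) : 1 ≤ embExcess x := by
  refine le_trans ?_ (sq_sub_one_le_embExcess hx h0 σ₀)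
  nlinarith

/-! ## The CM field: norm one at every embedding `⟺ c x · x = 1` -/

/-- For a conjugation `c` intertwined with complex conjugation by every embedding, `‖σ x‖ = 1` at every `σ` is the
same as `c x · x = 1`. -/
theorem forall_norm_eq_one_iff {c : E ≃+* E} (hc : ∀ (σ : E →+* ℂ) (y : E), σ (c y) = conj (σ y)) (x : E) :
    (∀ σ : E →+* ℂ, ‖σ x‖ = 1) ↔ c x * x = 1 := by
  constructor
  · intro h
    obtain ⟨σ⟩ := (inferInstance : Nonempty (E →+* ℂ))
    apply σ.injective
    rw [map_mul, hc, map_one, Complex.conj_mul', h σ]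
    norm_num
  · intro h σ
    have h1 := congrArg σ h
    rw [map_mul, hc, map_one, Complex.conj_mul'] at h1
    have h2 : (‖σ x‖ ^ 2 : ℝ) = 1 := by exact_mod_cast h1
    have h3 : 0 ≤ ‖σ x‖ := norm_nonneg _
    nlinarith [h2, h3]

/-- **THE EXCESS OF AN INTEGRAL SCALAR THAT IS NOT NORM-ONE IS POSITIVE.** -/
theorem embExcess_pos_of_conj_mul_ne_one {c : E ≃+* E} (hc : ∀ (σ : E →+* ℂ) (y : E), σ (c y) = conj (σ y))
    {x : E} (hx : IsIntegral ℤ x) (h0 : x ≠ 0) (hne : c x * x ≠ 1) : 0 < embExcess x := by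
  have : ¬ ∀ σ : E →+* ℂ, ‖σ x‖ = 1 := fun h => hne ((forall_norm_eq_one_iff hc x).1 h)
  obtain ⟨σ₀, hσ₀⟩ := not_forall.mp this
  exact embExcess_pos_of_norm_ne_one hx h0 hσ₀

/-- **THE UNIFORM GAP**: there is `δ > 0` with `embExcess x ≥ δ` for EVERY non-zero algebraic integer `x` of `E` with
`c x · x ≠ 1` (finitely many algebraic integers of house `≤ 2`; house `> 2` gives excess `≥ 1`). -/
theorem exists_embExcess_gap {c : E ≃+* E} (hc : ∀ (σ : E →+* ℂ) (y : E), σ (c y) = conj (σ y)) :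
    ∃ δ : ℝ, 0 < δ ∧ ∀ x : E, IsIntegral ℤ x → x ≠ 0 → c x * x ≠ 1 → δ ≤ embExcess x := by
  classical
  have hS : {x : E | IsIntegral ℤ x ∧ ∀ φ : E →+* ℂ, ‖φ x‖ ≤ 2}.Finite :=
    NumberField.Embeddings.finite_of_norm_le E ℂ 2
  set T : Finset E := hS.toFinset.filter (fun x => x ≠ 0 ∧ c x * x ≠ 1) with hT
  have hmemT : ∀ x : E, x ∈ T ↔ (IsIntegral ℤ x ∧ ∀ φ : E →+* ℂ, ‖φ x‖ ≤ 2) ∧ (x ≠ 0 ∧ c x * x ≠ 1) := by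
    intro x
    rw [hT, Finset.mem_filter, Set.Finite.mem_toFinset, Set.mem_setOf_eq]
  -- the bound for the large elements
  have hlarge : ∀ x : E, IsIntegral ℤ x → x ≠ 0 → (¬ ∀ φ : E →+* ℂ, ‖φ x‖ ≤ 2) → 1 ≤ embExcess x := by
    intro x hx h0 hh
    obtain ⟨φ, hφ⟩ := not_forall.mp hh
    exact one_le_embExcess_of_two_le hx h0 (not_le.mp hφ).le
  by_cases hne : T.Nonempty
  · obtain ⟨x₀, hx₀, hmin⟩ := T.exists_min_image embExcess hne
    have hx₀' := (hmemT x₀).1 hx₀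
    have hpos : 0 < embExcess x₀ := embExcess_pos_of_conj_mul_ne_one hc hx₀'.1.1 hx₀'.2.1 hx₀'.2.2
    refine ⟨min 1 (embExcess x₀), lt_min one_pos hpos, fun x hx h0 hcx => ?_⟩
    by_cases hh : ∀ φ : E →+* ℂ, ‖φ x‖ ≤ 2
    · exact (min_le_right _ _).trans (hmin x ((hmemT x).2 ⟨⟨hx, hh⟩, h0, hcx⟩))
    · exact (min_le_left _ _).trans (hlarge x hx h0 hh)
  · refine ⟨1, one_pos, fun x hx h0 hcx => ?_⟩
    by_cases hh : ∀ φ : E →+* ℂ, ‖φ x‖ ≤ 2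
    · exact absurd ⟨x, (hmemT x).2 ⟨⟨hx, hh⟩, h0, hcx⟩⟩ hne
    · exact hlarge x hx h0 hh

end Summit.Ventures.HodgeRepro.Tier4.Line3

end
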